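import Summits.Langlands.Langlands.Theses.SteinbergArtinDedekind
import Literature.NumberTheory.Automorphic.CompletedCohomologyHeckeAlgebraGLn
import Literature.FieldTheory.AlgClosed.PadicAlgClEquivComplex

/-!
# BIRTH SKELETON (BC3) — crux stmt-Langlands-11801 `SteinbergArtinDedekind.ArtinWeightLifting`
(route `route-Langlands-SteinbergArtinDedekind`, rank 2), line `birth` = the route's own TWO-LAYER PLAN
`ArtinWeightLifting ⇐ ProAutomorphyBigRT → ArtinWeightClassicality` (k = 2), TYPED.

Registered by `planner-skel-stmt-Langlands-11801-0` (skeleton registrar, 2026-08-17).  Two NAMED stubs, the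
kernel-checked composition `ArtinWeightLifting_of : ArtinWeightLifting` (BY NAME, the stubs used by name in its body —
the shape `#h21_check_skeleton` registers) and, as an `example`, the same composition in hypothetical form
`<stub₁-sig> → <stub₂-sig> → ArtinWeightLifting` (sorry-free pure logic).

## The cut

Fix `ℓ ≥ 5`, `ρ̄ : Γ_ℚ ↠ GL₂(𝔽_ℓ)` odd, `σ : Γ_ℚ → GL_ℓ(ℂ)` with the Steinberg character of `ρ̄`, and (the
crux hypothesis) a weight-zero cuspidal `Π` on `GL_ℓ/ℚ` congruent to `σ` modulo a prime `𝔩 ∣ ℓ` of `ℤ̄`.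
Choose a field isomorphism `ι : ℚ̄_ℓ ≃ ℂ` (exists: `PadicAlgCl.nonempty_ringEquiv_complex`, PROVED in
`Literature.FieldTheory.AlgClosed.PadicAlgClEquivComplex`) and let `r = ι⁻¹ ∘ σ : Γ_ℚ → GL_ℓ(ℚ̄_ℓ)` be the
entrywise `ℓ`-adic avatar of `σ` (finite image, Hodge–Tate weights `0^ℓ`, NOT trianguline at `ℓ` in the
niveau-2 regime — so the finite-slope eigenvariety is the wrong host; the completed-cohomology big Hecke
algebra sees every slope).

* `stub_proAutomorphyBigRT` (= ProAutomorphyBigRT, GL_ℓ/ℚ completed-cohomology form; OPEN, the rank-3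
  child foreseen by the route): under the crux hypotheses, for every `ι` there are an `S`-good tame level
  `𝒰 : TameLevel ℓ ℚ ℓ` of `GL_ℓ/ℚ` and the avatar `r` of `σ` such that `r` is `ℓ`-ADICALLY AUTOMORPHIC of tame
  level `𝒰` (`TameLevel.IsPadicallyAutomorphic`: `r` is associated — unramified with
  `charpoly r(Frob_v) = x(P_v)` off `S` — with a CONTINUOUS `ℚ̄_ℓ`-point `x` of the big Hecke algebra
  `𝕋(K^ℓ) = CompletedCohomologyHeckeAlgebraGLn 𝒰` of Scholze / Calegari–Emerton / Gee–Newton).  Content: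
  the residual door is free (`r̄ ≅ Sym^(ℓ−1) ρ̄ ≅ r̄_ι(Π)`, `Π` of weight zero contributes to
  `H^•(X_U, ℤ/ℓ^s)`, so `𝔪 = 𝔪_Π` is a non-Eisenstein maximal ideal of `𝕋(K^ℓ)` with `ρ̄_𝔪 = r̄`); the claim is
  that the point `r ∈ Spf R_(r̄,S)` lies in `Spf 𝕋(K^ℓ)_𝔪`, i.e. the "big `R_S = 𝕋_𝔪`" statement of
  [cite: GeeNewton2020, Conj. 3.3.2, §3.3] / [cite: CalegariGeraghty2017] / [cite: HansenUniversalEigenvarieties2017,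
  Conj. 1.2.3] at ONE point, for `GL_ℓ/ℚ` at `p = ℓ = n` with `l₀ = (ℓ−1)/2 > 0` (adequate image for `ℓ ≥ 5`,
  GuralnickHerzigTiep2017 Cor. 9.4).  Known for `n = 2` (Böckle, Emerton: infinite fern + `R = 𝕋`).
* `stub_artinWeightClassicality` (= ArtinWeightClassicality; OPEN): for the same family, an `ℓ`-adically
  automorphic avatar `r` of `σ` is CLASSICAL OF ARTIN TYPE: there is a cuspidal `π` on `GL_ℓ(𝔸_ℚ)` whose Satake
  parameters match the Frobenius characteristic polynomials of `σ` at all but finitely many places (verbatim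
  the crux conclusion).  Template: Pan2022 (`GL₂/ℚ`, Hodge–Tate weights `(0,0)`: pro-modular + de Rham at
  singular Sen weight ⇒ classical weight one), Emerton 2011 (local–global compatibility in completed
  cohomology ⇒ Fontaine–Mazur); step zero over CM fields: arXiv:2605.03519 (DPS infinitesimal character of
  completed cohomology of `GL_n`).  Sibling typed statement in the tree (same shape, `GL₂` over a CM field at
  `p = 3`): crux `EvenIcosahedralCMCorner.ArtinPointClassicalityCM`.

Neither stub is the crux or the summit in costume: stub 1 concludes PRO-automorphy (a statement about
completed cohomology, not implied by `Langlands`), stub 2 assumes it; the BC3 probes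
`stub → ArtinWeightLifting` / `stub → Langlands` by `first | exact? | simpa | aesop` fail (bc/ probes, NOTES.md).

Disproof used: none — no `Disproof.lean` exists on this crux at registration time (`ledger crux ls`: no
workfiles).  Dead lines: none recorded.  Barrier honoured: `Literature.Barriers.Langlands.NonRegularWeightBarrier`
is isolated in stub 2 exactly as the route header says (all patching/`R = 𝕋` content with no weight condition
sits in stub 1; the singular-weight classicality is stub 2).

Leans on (by name): `Summit.Langlands.Langlands.Theses.SteinbergArtinDedekind.ArtinWeightLifting` (the crux),
`Literature.NumberTheory.Automorphic.BigHeckeGLn.TameLevel`, `…TameLevel.IsPadicallyAutomorphic`,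
`CompletedCohomologyHeckeAlgebraGLn` (constructed, no named fact in its cone), `PadicAlgCl.nonempty_ringEquiv_complex`
(proved), `FramedGaloisRep.IsUnramifiedAt/HasFrobCharpolyAt`, `CuspidalAutomorphicRepData`, `HasSatakeParamAt`,
`satakePolynomial`.
-/

noncomputable section

open scoped BigOperators Topology Manifold Classical MeasureTheory ProbabilityTheory Matrix InnerProductSpace ComplexConjugate ContinuousMap
open scoped MatrixGroups NumberField Polynomial
open Filter Set Function TopologicalSpace MeasureTheory
open Literature.NumberTheory.Automorphic Literature.NumberTheory.GaloisRepresentations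
open Literature.NumberTheory.Automorphic.BigHeckeGLn

-- `Summit.Langlands.Langlands.…`: summit = sub-problem name (D-0017 nested layout), not a typo.
set_option linter.dupNamespace false

namespace Summit.Langlands.Langlands.Cruxes.ArtinWeightLifting.Birth

/-- **STUB 1 — `ProAutomorphyBigRT` (completed cohomology of `GL_ℓ/ℚ`).**  Under the hypotheses of the
crux (`ℓ ≥ 5`, `ρ̄` surjective odd, `σ` Steinberg-of-`ρ̄`, `σ` congruent mod `𝔩 ∣ ℓ` to a weight-zero cuspidal
`Π` on `GL_ℓ/ℚ`), for every field isomorphism `ι : ℚ̄_ℓ ≃ ℂ` there are an `S`-good tame level `𝒰` of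
`GL_ℓ/ℚ` at `p = ℓ` and the entrywise `ℓ`-adic avatar `r = ι⁻¹ ∘ σ` such that `r` is `ℓ`-adically automorphic
of tame level `𝒰` (a continuous `ℚ̄_ℓ`-point of `𝕋(K^ℓ)` associated with `r`).  Big `R_S = 𝕋_𝔪` at the point
`r` [cite: GeeNewton2020, Conj. 3.3.2] [cite: CalegariGeraghty2017] — OPEN for `n = ℓ ≥ 5`. -/
theorem stub_proAutomorphyBigRT :
    ∀ (ℓ : ℕ) [Fact ℓ.Prime], 5 ≤ ℓ → ∀ (ρ : Literature.NumberTheory.GaloisRepresentations.FramedGaloisRep ℚ (ZMod ℓ) 2) (σ : Literature.NumberTheory.GaloisRepresentations.FramedGaloisRep ℚ ℂ ℓ), Function.Surjective ρ → ρ.IsOdd → (∀ g, ((σ g : Matrix (Fin ℓ) (Fin ℓ) ℂ)).trace = ((Nat.card {w : Fin 2 → ZMod ℓ // w ≠ 0 ∧ ∃ a : ZMod ℓ, ((ρ g : Matrix (Fin 2) (Fin 2) (ZMod ℓ))).mulVec w = a • w} : ℂ)) / ((ℓ : ℂ) - 1) - 1) → (∃ (hcpt' : Literature.NumberTheory.Automorphic.isCompact_glFiniteIntegralLevel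 ℓ ℚ) (piR : Literature.NumberTheory.Automorphic.CuspidalAutomorphicRepData ℓ ℚ hcpt'), piR.1.HasWeightZero ∧ ∃ 𝔩 : Ideal ↥(integralClosure ℤ ℂ), 𝔩.IsMaximal ∧ ((ℓ : ℕ) : ↥(integralClosure ℤ ℂ)) ∈ 𝔩 ∧ ∀ᶠ v : IsDedekindDomain.HeightOneSpectrum (NumberField.RingOfIntegers ℚ) in Filter.cofinite, ∃ (P : Polynomial ↥(integralClosure ℤ ℂ)) (Q : Polynomial ℤ), piR.1.HasHeckePolynomialAt v (P.map (algebraMap ↥(integralClosure ℤ ℂ) ℂ)) ∧ σ.IsUnramifiedAt v ∧ σ.HasFrobCharpolyAt v (Q.map (Int.castRingHom ℂ)) ∧ P.map (Ideal.Quotient.mk 𝔩) = (Q.map (Int.castRingHom ↥(integralClosure ℤ ℂ))).map (Ideal.Quotient.mk 𝔩)) → ∀ ι : PadicAlgCl ℓ ≃+* ℂ, ∃ (𝒰 : Literature.NumberTheory.Automorphic.BigHeckeGLn.TameLevel ℓ ℚ ℓ) (r : Literature.NumberTheory.GaloisRepresentations.FramedGaloisRep ℚ (PadicAlgCl ℓ)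 ℓ), (∀ g, (((r g : GL (Fin ℓ) (PadicAlgCl ℓ)) : Matrix (Fin ℓ) (Fin ℓ) (PadicAlgCl ℓ))).map ι = ((σ g : GL (Fin ℓ) ℂ) : Matrix (Fin ℓ) (Fin ℓ) ℂ)) ∧ 𝒰.IsPadicallyAutomorphic r := by
  sorry

/-- **STUB 2 — `ArtinWeightClassicality` (Artin-type points of `𝕋(K^ℓ)` are classical).**  For `ℓ ≥ 5`,
`ρ̄` surjective odd and `σ` Steinberg-of-`ρ̄` (so `σ ≅ St ∘ ρ̄` is irreducible of dimension `ℓ`, Hodge–Tate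
weights `0^ℓ`): if the entrywise `ℓ`-adic avatar `r` of `σ` along `ι` is `ℓ`-adically automorphic of some
`S`-good tame level `𝒰` of `GL_ℓ/ℚ`, then `σ` is automorphic — a cuspidal `π` on `GL_ℓ(𝔸_ℚ)` with a.e.
Satake–Frobenius matching (verbatim the crux conclusion).  Pan2022-shape classicality at the SINGULAR
weight on `GL_ℓ/ℚ` [cite: Pan2022] — OPEN for `n = ℓ ≥ 5`
(`Literature.Barriers.Langlands.NonRegularWeightBarrier` lives here). -/
theorem stub_artinWeightClassicality :
    ∀ (ℓ : ℕ) [Fact ℓ.Prime], 5 ≤ ℓ → ∀ (ρ : Literature.NumberTheory.GaloisRepresentations.FramedGaloisRep ℚ (ZMod ℓ) 2) (σ : Literature.NumberTheory.GaloisRepresentations.FramedGaloisRep ℚ ℂ ℓ), Function.Surjective ρ → ρ.IsOdd → (∀ g, ((σ g : Matrix (Fin ℓ) (Fin ℓ) ℂ)).trace = ((Nat.card {w : Fin 2 → ZMod ℓ // w ≠ 0 ∧ ∃ a : ZMod ℓ, ((ρ g : Matrix (Fin 2) (Fin 2) (ZMod ℓ))).mulVec w = a • w} : ℂ)) / ((ℓ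 : ℂ) - 1) - 1) → ∀ (ι : PadicAlgCl ℓ ≃+* ℂ) (𝒰 : Literature.NumberTheory.Automorphic.BigHeckeGLn.TameLevel ℓ ℚ ℓ) (r : Literature.NumberTheory.GaloisRepresentations.FramedGaloisRep ℚ (PadicAlgCl ℓ) ℓ), (∀ g, (((r g : GL (Fin ℓ) (PadicAlgCl ℓ)) : Matrix (Fin ℓ) (Fin ℓ) (PadicAlgCl ℓ))).map ι = ((σ g : GL (Fin ℓ) ℂ) : Matrix (Fin ℓ) (Fin ℓ) ℂ)) → 𝒰.IsPadicallyAutomorphic r → ∃ (hcpt : Literature.NumberTheory.Automorphic.isCompact_glFiniteIntegralLevel ℓ ℚ) (π : Literature.NumberTheory.Automorphic.CuspidalAutomorphicRepData ℓ ℚ hcpt), ∀ᶠ v : IsDedekindDomain.HeightOneSpectrum (NumberField.RingOfIntegers ℚ) in Filter.cofinite, ∃ α : Multiset ℂ, π.1.HasSatakeParamAt v α ∧ σ.IsUnramifiedAt v ∧ σ.HasFrobCharpolyAt v (Literature.NumberTheory.Automorphic.satakePolynomial α) := by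
  sorry

/-- **The crux BY NAME from the two stubs** (the registered skeleton theorem: no hypotheses, the two
declared stubs used by name in the body): pick `ι : ℚ̄_ℓ ≃+* ℂ` (`PadicAlgCl.nonempty_ringEquiv_complex`,
proved), take the `ℓ`-adically automorphic avatar of stub 1 and feed it to stub 2. [folklore] -/
theorem ArtinWeightLifting_of :
    Summit.Langlands.Langlands.Theses.SteinbergArtinDedekind.ArtinWeightLifting := by
  intro ℓ _ hℓ ρ σ hsurj hodd hchar hcong
  obtain ⟨ι⟩ := PadicAlgCl.nonempty_ringEquiv_complex ℓ
  obtain ⟨𝒰, r, hr, hpa⟩ := stub_proAutomorphyBigRT ℓ hℓ ρ σ hsurj hodd hchar hcong ι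
  exact stub_artinWeightClassicality ℓ hℓ ρ σ hsurj hodd hchar ι 𝒰 r hr hpa

/-- **The same composition as PURE LOGIC, hypothetical form** `<stub₁-sig> → <stub₂-sig> → ArtinWeightLifting`
(sorry-free and axiom-clean: this is the real proof that the two stub statements imply the crux; written as an
`example` so that the skeleton audit sees exactly one theorem concluding the crux). [folklore] -/
example :
    (∀ (ℓ : ℕ) [Fact ℓ.Prime], 5 ≤ ℓ → ∀ (ρ : Literature.NumberTheory.GaloisRepresentations.FramedGaloisRep ℚ (ZMod ℓ) 2) (σ : Literature.NumberTheory.GaloisRepresentations.FramedGaloisRep ℚ ℂ ℓ), Function.Surjective ρ → ρ.IsOdd → (∀ g, ((σ g : Matrix (Fin ℓ) (Fin ℓ) ℂ)).trace = ((Nat.card {w : Fin 2 → ZMod ℓ // w ≠ 0 ∧ ∃ a : ZMod ℓ, ((ρ g : Matrix (Fin 2) (Fin 2) (ZMod ℓ))).mulVec w = a • w} : ℂ)) / ((ℓ : ℂ) - 1) - 1) → (∃ (hcpt' : Literature.NumberTheory.Automorphic.isCompact_glFiniteIntegralLevel ℓ ℚ) (piR : Literature.NumberTheory.Automorphic.CuspidalAutomorphicRepData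 ℓ ℚ hcpt'), piR.1.HasWeightZero ∧ ∃ 𝔩 : Ideal ↥(integralClosure ℤ ℂ), 𝔩.IsMaximal ∧ ((ℓ : ℕ) : ↥(integralClosure ℤ ℂ)) ∈ 𝔩 ∧ ∀ᶠ v : IsDedekindDomain.HeightOneSpectrum (NumberField.RingOfIntegers ℚ) in Filter.cofinite, ∃ (P : Polynomial ↥(integralClosure ℤ ℂ)) (Q : Polynomial ℤ), piR.1.HasHeckePolynomialAt v (P.map (algebraMap ↥(integralClosure ℤ ℂ) ℂ)) ∧ σ.IsUnramifiedAt v ∧ σ.HasFrobCharpolyAt v (Q.map (Int.castRingHom ℂ)) ∧ P.map (Ideal.Quotient.mk 𝔩) = (Q.map (Int.castRingHom ↥(integralClosure ℤ ℂ))).map (Ideal.Quotient.mk 𝔩)) → ∀ ι : PadicAlgCl ℓ ≃+* ℂ, ∃ (𝒰 : Literature.NumberTheory.Automorphic.BigHeckeGLn.TameLevel ℓ ℚ ℓ) (r : Literature.NumberTheory.GaloisRepresentations.FramedGaloisRep ℚ (PadicAlgCl ℓ) ℓ), (∀ g, (((r g : GL (Fin ℓ) (PadicAlgCl ℓ)) :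 Matrix (Fin ℓ) (Fin ℓ) (PadicAlgCl ℓ))).map ι = ((σ g : GL (Fin ℓ) ℂ) : Matrix (Fin ℓ) (Fin ℓ) ℂ)) ∧ 𝒰.IsPadicallyAutomorphic r) →
    (∀ (ℓ : ℕ) [Fact ℓ.Prime], 5 ≤ ℓ → ∀ (ρ : Literature.NumberTheory.GaloisRepresentations.FramedGaloisRep ℚ (ZMod ℓ) 2) (σ : Literature.NumberTheory.GaloisRepresentations.FramedGaloisRep ℚ ℂ ℓ), Function.Surjective ρ → ρ.IsOdd → (∀ g, ((σ g : Matrix (Fin ℓ) (Fin ℓ) ℂ)).trace = ((Nat.card {w : Fin 2 → ZMod ℓ // w ≠ 0 ∧ ∃ a : ZMod ℓ, ((ρ g : Matrix (Fin 2) (Fin 2) (ZMod ℓ))).mulVec w = a • w} : ℂ)) / ((ℓ : ℂ) - 1) - 1) → ∀ (ι : PadicAlgCl ℓ ≃+* ℂ) (𝒰 : Literature.NumberTheory.Automorphic.BigHeckeGLn.TameLevel ℓ ℚ ℓ) (r : Literature.NumberTheory.GaloisRepresentations.FramedGaloisRep ℚ (PadicAlgCl ℓ) ℓ), (∀ g,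 (((r g : GL (Fin ℓ) (PadicAlgCl ℓ)) : Matrix (Fin ℓ) (Fin ℓ) (PadicAlgCl ℓ))).map ι = ((σ g : GL (Fin ℓ) ℂ) : Matrix (Fin ℓ) (Fin ℓ) ℂ)) → 𝒰.IsPadicallyAutomorphic r → ∃ (hcpt : Literature.NumberTheory.Automorphic.isCompact_glFiniteIntegralLevel ℓ ℚ) (π : Literature.NumberTheory.Automorphic.CuspidalAutomorphicRepData ℓ ℚ hcpt), ∀ᶠ v : IsDedekindDomain.HeightOneSpectrum (NumberField.RingOfIntegers ℚ) in Filter.cofinite, ∃ α : Multiset ℂ, π.1.HasSatakeParamAt v α ∧ σ.IsUnramifiedAt v ∧ σ.HasFrobCharpolyAt v (Literature.NumberTheory.Automorphic.satakePolynomial α)) →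
    Summit.Langlands.Langlands.Theses.SteinbergArtinDedekind.ArtinWeightLifting := by
  intro hRT hCl ℓ _ hℓ ρ σ hsurj hodd hchar hcong
  obtain ⟨ι⟩ := PadicAlgCl.nonempty_ringEquiv_complex ℓ
  obtain ⟨𝒰, r, hr, hpa⟩ := hRT ℓ hℓ ρ σ hsurj hodd hchar hcong ι
  exact hCl ℓ hℓ ρ σ hsurj hodd hchar ι 𝒰 r hr hpa

/-- Sanity (read-back): the conclusion of `ArtinWeightLifting_of` is the route decl, and the route decl
unfolds to the verbatim crux text used to cut the stubs. [bookkeeping] -/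
example : Summit.Langlands.Langlands.Theses.SteinbergArtinDedekind.ArtinWeightLifting ↔
    (∀ (ℓ : ℕ) [Fact ℓ.Prime], 5 ≤ ℓ → ∀ (ρ : Literature.NumberTheory.GaloisRepresentations.FramedGaloisRep ℚ (ZMod ℓ) 2) (σ : Literature.NumberTheory.GaloisRepresentations.FramedGaloisRep ℚ ℂ ℓ), Function.Surjective ρ → ρ.IsOdd → (∀ g, ((σ g : Matrix (Fin ℓ) (Fin ℓ) ℂ)).trace = ((Nat.card {w : Fin 2 → ZMod ℓ // w ≠ 0 ∧ ∃ a : ZMod ℓ, ((ρ g : Matrix (Fin 2) (Fin 2) (ZMod ℓ))).mulVec w = a • w} : ℂ)) / ((ℓ : ℂ) - 1) - 1) → (∃ (hcpt' : Literature.NumberTheory.Automorphic.isCompact_glFiniteIntegralLevel ℓ ℚ) (piR : Literature.NumberTheory.Automorphic.CuspidalAutomorphicRepData ℓ ℚ hcpt'), piR.1.HasWeightZero ∧ ∃ 𝔩 : Ideal ↥(integralClosure ℤ ℂ), 𝔩.IsMaximal ∧ ((ℓ : ℕ) : ↥(integralClosure ℤ ℂ)) ∈ 𝔩 ∧ ∀ᶠ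 v : IsDedekindDomain.HeightOneSpectrum (NumberField.RingOfIntegers ℚ) in Filter.cofinite, ∃ (P : Polynomial ↥(integralClosure ℤ ℂ)) (Q : Polynomial ℤ), piR.1.HasHeckePolynomialAt v (P.map (algebraMap ↥(integralClosure ℤ ℂ) ℂ)) ∧ σ.IsUnramifiedAt v ∧ σ.HasFrobCharpolyAt v (Q.map (Int.castRingHom ℂ)) ∧ P.map (Ideal.Quotient.mk 𝔩) = (Q.map (Int.castRingHom ↥(integralClosure ℤ ℂ))).map (Ideal.Quotient.mk 𝔩)) → ∃ (hcpt : Literature.NumberTheory.Automorphic.isCompact_glFiniteIntegralLevel ℓ ℚ) (π : Literature.NumberTheory.Automorphic.CuspidalAutomorphicRepData ℓ ℚ hcpt), ∀ᶠ v : IsDedekindDomain.HeightOneSpectrum (NumberField.RingOfIntegers ℚ) in Filter.cofinite, ∃ α : Multiset ℂ, π.1.HasSatakeParamAt v α ∧ σ.IsUnramifiedAt v ∧ σ.HasFrobCharpolyAt v (Literature.NumberTheory.Automorphic.satakePolynomial α)) :=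
  Iff.rfl

end Summit.Langlands.Langlands.Cruxes.ArtinWeightLifting.Birth

end
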